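/-
Copyright (c) 2026 the pub-hodgecm-mathlib formalisation cell (harness21).  Prover seat hodgecm-mathlib-F0P3a-p01 (g22), 2026-09-02.
-/
import Summits.HodgeConjecture.HodgeConjecture.Theorems.F0P3cStCharTSWeylFinite      -- ★ G-side twin (F0P3a-p03 (g23)): brings ★ `F0P3cStCharTSTracePairing.index_centralizer_subgroupOf_normalizer_ne_zero_of_injective` (the engine) + ★ `TypeThreeTorus.isRegularElt_iff_separable_localNonsplitEquiv`
import Literature.NumberTheory.Rogawski1990.LocalTransfer                             -- ★ `IsLocalGRegular` (:581), ★ `endoEmbLocal` ∕ `endoEmbLocal_injective` (via `EndoscopicEmbedding`)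
import Literature.NumberTheory.Rogawski1990.Ch12Sec5Defs                              -- ★ `Ch12Sec5.weylOrder`
import HarnessLib

/-!
# F0 · P3c · line LH6 «StCharTS» — ROAD «UP-TR», brick (H3a) «WEYL-FIN-H»: the Weyl group `N_H(Z_H(γ_H)) ∕ Z_H(γ_H)` of a `G`-REGULAR
# `γ_H ∈ H_v = U(Φ₂)(L⁺_v) × U(Φ₁)(L⁺_v)` is FINITE [Rogawski1990, §3.5 p. 28; §12.5 p. 182–183] [HarishChandra1970, Lemma 42]

Cell `pub/hodgecm-mathlib`, crux H413 = `stmt-HodgeConjecture-24833` (lane `--supports … --as helper`, route HCCMUnconditional); seat F0P3a-p01 (g22).  ROAD «UP-TR»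
(LEAD F0P3a-plan (g15) T14-21 «A», holder ∕ dealer F0P3-p02 (g23), road file `F0/P3/F0P3-p02/g23/ROAD-UP-TR.v1.F0P3p02g23.md` §3 brick (H3a), DEAL #1 2026-09-02T18:15:06Z):
the `H_v`-twin of ★ `F0P3cStCharTSWeylFinite` (the `G`-side «WEYL-FIN★», F0P3a-p03 (g23)).  THEOREMS ONLY (no definition ∕ instance ∕ notation ∕ named fact ∕ `sorry`); ★-only imports.

WHAT.  The `H`-side Weyl integration formula of the «up-transfer» road (consequent `hUpTr` of RUNG0 v5's named block, = clause 3 of ★ `Ch12Sec5.EllipticData.UpSpec`;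
[Rogawski1990, §12.5 p. 183, Lemma 12.5.1]) weights each Cartan subgroup `T_H = Z_H(γ_H)` of `H_v` (road letter: `γ_H` `G`-regular, ★ `IsLocalGRegular L v γ_H`) by
`[N_H(T_H) : T_H]⁻¹` (road letter: `(T.subgroupOf (Subgroup.normalizer (T : Set H_v))).index` = ★ `Ch12Sec5.weylOrder T`).  This file proves that this index is a genuine positive
integer at every NON-SPLIT place `v`:
* **`isLocalGRegular_iff_isRegularElt_endoEmbLocal`** — `IsLocalGRegular L v γ_H ↔ IsRegularElt (ι_v γ_H)` (definitional; ★ `endoEmbLocal`);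
* **`isLocalGRegular_iff_separable`** — at a place `w ∣ v` fixed by `c`: `G`-regularity of `γ_H` is separability of the characteristic polynomial of `ρ_w(γ_H) ∈ GL₃(L_w)`, where
  `ρ_w := (one-place model ★ `localNonsplitEquiv` of `U(Φ₃)(L⁺_v)`) ∘ ι_v : H_v →* GL₃(L_w)` is the FAITHFUL three-dimensional representation of `H_v`
  (**`injective_onePlaceRep_comp_endoEmbLocal`**);
* **`index_centralizer_subgroupOf_normalizer_ne_zero`** — for `G`-regular `γ_H : H_v`, `((Z_H(γ_H)).subgroupOf N_H(Z_H(γ_H))).index ≠ 0`: the ★ GENERIC engine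
  `F0P3cStCharTSTracePairing.index_centralizer_subgroupOf_normalizer_ne_zero_of_injective` («`n ↦ ρ(n γ n⁻¹)` maps `N(Z(γ))` into the finite set of commutant elements with
  the characteristic polynomial of `ρ γ`, fibres = cosets of `Z(γ)`») at `ρ_w`;
* riders **`index_centralizer_subgroupOf_normalizer_pos`**, **`finite_normalizer_quotient_centralizer`**, **`weylOrder_centralizer_ne_zero`** ∕ **`_pos`** (the road letter's
  `Ch12Sec5.weylOrder (Z_H γ_H)`, by definitional unfolding of ★ `weylOrder` — `Nat.card` of the coset space).
Print's VALUES `|Ω_F(T_H, H)| ∈ {1, 2}` per type [§3.6] are NOT here (road brick (N3) ∕ S9d).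

HONEST LABEL (ROAD «UP-TR», LEAD T14-21 (7)): count-neutral; block consequents 11 → 10 → 9 only at the rider editions; organs 2 = 2; h413 registry untouched; HC_CM is
proved only modulo the printed citations (2 remaining named inputs: hLiu418 = `stmt-HodgeConjecture-24832`, h413 = `stmt-HodgeConjecture-24833`) until rung 0 closes.

## References
* [Rogawski1990] J. D. Rogawski, *Automorphic Representations of Unitary Groups in Three Variables*, Ann. of Math. Stud. 123 (1990): §3.5 p. 28 (`Ω_F(T, G) = N_G(T)(F) ∕ T(F)`),
  §3.6 pp. 28–31, §4.3 p. 42 (`G`-regular elements of `H`), §12.5 pp. 182–183 (the weights `|Ω_F(T, ·)|⁻¹` of the Weyl integration formulae on `G` and `H`, Lemma 12.5.1).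
* [HarishChandra1970] Harish-Chandra (notes by G. van Dijk), *Harmonic Analysis on Reductive p-adic Groups*, LNM 162 (1970), Lemma 42 (`W_A = Ã ∕ A` is finite).
-/

set_option autoImplicit false
-- the mandated namespace has the single-problem summit's repeated segment (`HodgeConjecture.HodgeConjecture`)
set_option linter.dupNamespace false

noncomputable section

open NumberField IsDedekindDomain
open scoped Matrix MatrixGroups
open Literature.NumberTheory.Rogawski1990 Literature.NumberTheory.Automorphic Literature.NumberTheory.Automorphic.UnitaryGroup
open Literature.NumberTheory.Rogawski1990.TypeThreeTorus
open Summit.HodgeConjecture.HodgeConjecture.Cruxes.H413.F0P3cStCharTSTracePairing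

namespace Summit.HodgeConjecture.HodgeConjecture.Cruxes.H413.F0P3cStCharTSUpTrWeylFinH

variable (L : Type) [Field L] [NumberField L] [IsCMField L] (v : HeightOneSpectrum (𝓞 ↥(maximalRealSubfield L)))

/-! ## §1 `G`-regularity of `γ_H` read on the faithful three-dimensional representation `ρ_w = (one-place model) ∘ ι_v` -/

/-- `G`-regularity of `γ_H ∈ H_v` IS regularity of its endoscopic image `ι_v(γ_H) ∈ U(Φ₃)(L⁺_v) ≤ GL₃(∏_{w ∣ v} L_w)` (definitional: ★ `IsLocalGRegular` → ★ `IsGRegular` →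
★ `endoEmbLocal = endoEmb (conjLocal …) … (endoForm_localForm L v)`). [cite: Rogawski1990, §4.3 p. 42] -/
theorem isLocalGRegular_iff_isRegularElt_endoEmbLocal
    (γH : (UnitaryGroup.cmDatum L 2 (Matrix.of fun i j : Fin 2 => if i.val + j.val + 1 = 2 then (1 : L) else 0)).Local v ×
      (UnitaryGroup.cmDatum L 1 (Matrix.of fun i j : Fin 1 => if i.val + j.val + 1 = 1 then (1 : L) else 0)).Local v) :
    IsLocalGRegular L v γH ↔ IsRegularElt ((endoEmbLocal L v γH).val : GL (Fin 3) (LocalRing L v)) :=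
  Iff.rfl

/-- **The faithful representation `ρ_w : H_v →* GL₃(L_w)`** (`w ∣ v` fixed by `c`): the one-place model `U(Φ₃)(L⁺_v) ≃ U(σ_w, Φ₃)(L_w) ≤ GL₃(L_w)` (★ `localNonsplitEquiv`)
composed with the endoscopic embedding `ι_v` (★ `endoEmbLocal`) is INJECTIVE (★ `endoEmbLocal_injective`). [cite: Rogawski1990, §4.8 Case (a) p. 53; §3.1 p. 19] -/
theorem injective_onePlaceRep_comp_endoEmbLocal (w : PlacesOver L v) (hw : IsCMField.complexConj L • w.1 = w.1) :
    Function.Injective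
      (((unitaryGroupOfForm (galAdicCompletionMap (L := L) (IsCMField.complexConj L) hw) (placeForm (qsForm L) w.1)).subtype.comp
          (localNonsplitEquiv (IsCMField.complexConj L) (qsForm L) (IsCMField.complexConj_ne_one L) w hw).toMonoidHom).comp
        (endoEmbLocal L v)) :=
  (Subtype.val_injective.comp
      (localNonsplitEquiv (IsCMField.complexConj L) (qsForm L) (IsCMField.complexConj_ne_one L) w hw).injective).comp
    (endoEmbLocal_injective L v)

/-- **`G`-regularity = separability on the one-place model**: `γ_H` is `G`-regular iff the characteristic polynomial of `ρ_w(γ_H) ∈ GL₃(L_w)` is separable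
(★ `isRegularElt_iff_separable_localNonsplitEquiv` at `ι_v γ_H`). [cite: Rogawski1990, §3.1 p. 19; §4.3 p. 42] -/
theorem isLocalGRegular_iff_separable (w : PlacesOver L v) (hw : IsCMField.complexConj L • w.1 = w.1)
    (γH : (UnitaryGroup.cmDatum L 2 (Matrix.of fun i j : Fin 2 => if i.val + j.val + 1 = 2 then (1 : L) else 0)).Local v ×
      (UnitaryGroup.cmDatum L 1 (Matrix.of fun i j : Fin 1 => if i.val + j.val + 1 = 1 then (1 : L) else 0)).Local v) :
    IsLocalGRegular L v γH ↔
      (((((unitaryGroupOfForm (galAdicCompletionMap (L := L) (IsCMField.complexConj L) hw) (placeForm (qsForm L) w.1)).subtype.comp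
              (localNonsplitEquiv (IsCMField.complexConj L) (qsForm L) (IsCMField.complexConj_ne_one L) w hw).toMonoidHom).comp
            (endoEmbLocal L v)) γH : GL (Fin 3) (w.1.adicCompletion L)) : Matrix (Fin 3) (Fin 3) (w.1.adicCompletion L)).charpoly.Separable :=
  (isLocalGRegular_iff_isRegularElt_endoEmbLocal L v γH).trans (isRegularElt_iff_separable_localNonsplitEquiv L w hw (endoEmbLocal L v γH))

/-! ## §2 «WEYL-FIN-H»: the Weyl group of `Z_H(γ_H)` is finite for `G`-regular `γ_H` -/

/-- **«WEYL-FIN-H»: the Weyl group `N_H(Z_H(γ_H)) ∕ Z_H(γ_H)` of a `G`-REGULAR `γ_H ∈ H_v = U(Φ₂)(L⁺_v) × U(Φ₁)(L⁺_v)` is FINITE** (`v` non-split): the index of the centraliser in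
its normaliser is non-zero.  Generic ★ `index_centralizer_subgroupOf_normalizer_ne_zero_of_injective` at the faithful `ρ_w = (one-place model) ∘ ι_v`, `G`-regularity read as
separability there (§1). [cite: Rogawski1990, §3.5 p. 28; §12.5 pp. 182–183] [cite: HarishChandra1970, Lemma 42] -/
theorem index_centralizer_subgroupOf_normalizer_ne_zero (hns : ∀ w : PlacesOver L v, IsCMField.complexConj L • w.1 = w.1)
    (γH : (UnitaryGroup.cmDatum L 2 (Matrix.of fun i j : Fin 2 => if i.val + j.val + 1 = 2 then (1 : L) else 0)).Local v ×
      (UnitaryGroup.cmDatum L 1 (Matrix.of fun i j : Fin 1 => if i.val + j.val + 1 = 1 then (1 : L) else 0)).Local v)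
    (hreg : IsLocalGRegular L v γH) :
    ((Subgroup.centralizer ({γH} : Set ((UnitaryGroup.cmDatum L 2 (Matrix.of fun i j : Fin 2 => if i.val + j.val + 1 = 2 then (1 : L) else 0)).Local v ×
      (UnitaryGroup.cmDatum L 1 (Matrix.of fun i j : Fin 1 => if i.val + j.val + 1 = 1 then (1 : L) else 0)).Local v))).subgroupOf
      (Subgroup.normalizer ((Subgroup.centralizer ({γH} : Set ((UnitaryGroup.cmDatum L 2 (Matrix.of fun i j : Fin 2 => if i.val + j.val + 1 = 2 then (1 : L) else 0)).Local v ×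
      (UnitaryGroup.cmDatum L 1 (Matrix.of fun i j : Fin 1 => if i.val + j.val + 1 = 1 then (1 : L) else 0)).Local v)) : Subgroup ((UnitaryGroup.cmDatum L 2 (Matrix.of fun i j : Fin 2 => if i.val + j.val + 1 = 2 then (1 : L) else 0)).Local v ×
      (UnitaryGroup.cmDatum L 1 (Matrix.of fun i j : Fin 1 => if i.val + j.val + 1 = 1 then (1 : L) else 0)).Local v)) : Set ((UnitaryGroup.cmDatum L 2 (Matrix.of fun i j : Fin 2 => if i.val + j.val + 1 = 2 then (1 : L) else 0)).Local v ×
      (UnitaryGroup.cmDatum L 1 (Matrix.of fun i j : Fin 1 => if i.val + j.val + 1 = 1 then (1 : L) else 0)).Local v)))).index ≠ 0 := by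
  obtain ⟨w⟩ := (inferInstance : Nonempty (PlacesOver L v))
  have hw := hns w
  exact index_centralizer_subgroupOf_normalizer_ne_zero_of_injective _ (injective_onePlaceRep_comp_endoEmbLocal L v w hw) γH
    ((isLocalGRegular_iff_separable L v w hw γH).1 hreg)

/-- `0 < [N_H(Z_H(γ_H)) : Z_H(γ_H)]` for `G`-regular `γ_H ∈ H_v`, `v` non-split (the shape of a `weylF`-type field value). [cite: Rogawski1990, §3.5 p. 28; §12.5 p. 183] -/
theorem index_centralizer_subgroupOf_normalizer_pos (hns : ∀ w : PlacesOver L v, IsCMField.complexConj L • w.1 = w.1)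
    (γH : (UnitaryGroup.cmDatum L 2 (Matrix.of fun i j : Fin 2 => if i.val + j.val + 1 = 2 then (1 : L) else 0)).Local v ×
      (UnitaryGroup.cmDatum L 1 (Matrix.of fun i j : Fin 1 => if i.val + j.val + 1 = 1 then (1 : L) else 0)).Local v)
    (hreg : IsLocalGRegular L v γH) :
    0 < ((Subgroup.centralizer ({γH} : Set ((UnitaryGroup.cmDatum L 2 (Matrix.of fun i j : Fin 2 => if i.val + j.val + 1 = 2 then (1 : L) else 0)).Local v ×
      (UnitaryGroup.cmDatum L 1 (Matrix.of fun i j : Fin 1 => if i.val + j.val + 1 = 1 then (1 : L) else 0)).Local v))).subgroupOf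
      (Subgroup.normalizer ((Subgroup.centralizer ({γH} : Set ((UnitaryGroup.cmDatum L 2 (Matrix.of fun i j : Fin 2 => if i.val + j.val + 1 = 2 then (1 : L) else 0)).Local v ×
      (UnitaryGroup.cmDatum L 1 (Matrix.of fun i j : Fin 1 => if i.val + j.val + 1 = 1 then (1 : L) else 0)).Local v)) : Subgroup ((UnitaryGroup.cmDatum L 2 (Matrix.of fun i j : Fin 2 => if i.val + j.val + 1 = 2 then (1 : L) else 0)).Local v ×
      (UnitaryGroup.cmDatum L 1 (Matrix.of fun i j : Fin 1 => if i.val + j.val + 1 = 1 then (1 : L) else 0)).Local v)) : Set ((UnitaryGroup.cmDatum L 2 (Matrix.of fun i j : Fin 2 => if i.val + j.val + 1 = 2 then (1 : L) else 0)).Local v ×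
      (UnitaryGroup.cmDatum L 1 (Matrix.of fun i j : Fin 1 => if i.val + j.val + 1 = 1 then (1 : L) else 0)).Local v)))).index :=
  Nat.pos_of_ne_zero (index_centralizer_subgroupOf_normalizer_ne_zero L v hns γH hreg)

/-- `N_H(Z_H(γ_H)) ∕ Z_H(γ_H)` is a finite type for `G`-regular `γ_H ∈ H_v`, `v` non-split. [cite: HarishChandra1970, Lemma 42] [cite: Rogawski1990, §3.5 p. 28] -/
theorem finite_normalizer_quotient_centralizer (hns : ∀ w : PlacesOver L v, IsCMField.complexConj L • w.1 = w.1)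
    (γH : (UnitaryGroup.cmDatum L 2 (Matrix.of fun i j : Fin 2 => if i.val + j.val + 1 = 2 then (1 : L) else 0)).Local v ×
      (UnitaryGroup.cmDatum L 1 (Matrix.of fun i j : Fin 1 => if i.val + j.val + 1 = 1 then (1 : L) else 0)).Local v)
    (hreg : IsLocalGRegular L v γH) :
    Finite (↥(Subgroup.normalizer ((Subgroup.centralizer ({γH} : Set ((UnitaryGroup.cmDatum L 2 (Matrix.of fun i j : Fin 2 => if i.val + j.val + 1 = 2 then (1 : L) else 0)).Local v ×
      (UnitaryGroup.cmDatum L 1 (Matrix.of fun i j : Fin 1 => if i.val + j.val + 1 = 1 then (1 : L) else 0)).Local v)) : Subgroup ((UnitaryGroup.cmDatum L 2 (Matrix.of fun i j : Fin 2 => if i.val + j.val + 1 = 2 then (1 : L) else 0)).Local v ×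
      (UnitaryGroup.cmDatum L 1 (Matrix.of fun i j : Fin 1 => if i.val + j.val + 1 = 1 then (1 : L) else 0)).Local v)) : Set ((UnitaryGroup.cmDatum L 2 (Matrix.of fun i j : Fin 2 => if i.val + j.val + 1 = 2 then (1 : L) else 0)).Local v ×
      (UnitaryGroup.cmDatum L 1 (Matrix.of fun i j : Fin 1 => if i.val + j.val + 1 = 1 then (1 : L) else 0)).Local v))) ⧸
      (Subgroup.centralizer ({γH} : Set ((UnitaryGroup.cmDatum L 2 (Matrix.of fun i j : Fin 2 => if i.val + j.val + 1 = 2 then (1 : L) else 0)).Local v ×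
      (UnitaryGroup.cmDatum L 1 (Matrix.of fun i j : Fin 1 => if i.val + j.val + 1 = 1 then (1 : L) else 0)).Local v))).subgroupOf
        (Subgroup.normalizer ((Subgroup.centralizer ({γH} : Set ((UnitaryGroup.cmDatum L 2 (Matrix.of fun i j : Fin 2 => if i.val + j.val + 1 = 2 then (1 : L) else 0)).Local v ×
      (UnitaryGroup.cmDatum L 1 (Matrix.of fun i j : Fin 1 => if i.val + j.val + 1 = 1 then (1 : L) else 0)).Local v)) : Subgroup ((UnitaryGroup.cmDatum L 2 (Matrix.of fun i j : Fin 2 => if i.val + j.val + 1 = 2 then (1 : L) else 0)).Local v ×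
      (UnitaryGroup.cmDatum L 1 (Matrix.of fun i j : Fin 1 => if i.val + j.val + 1 = 1 then (1 : L) else 0)).Local v)) : Set ((UnitaryGroup.cmDatum L 2 (Matrix.of fun i j : Fin 2 => if i.val + j.val + 1 = 2 then (1 : L) else 0)).Local v ×
      (UnitaryGroup.cmDatum L 1 (Matrix.of fun i j : Fin 1 => if i.val + j.val + 1 = 1 then (1 : L) else 0)).Local v)))) :=
  (Subgroup.fintypeOfIndexNeZero (index_centralizer_subgroupOf_normalizer_ne_zero L v hns γH hreg)).finite

/-! ## §3 The road letter's `weylOrder` -/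

/-- **The road letter's Weyl index is a genuine positive integer**: `Ch12Sec5.weylOrder (Z_H(γ_H)) ≠ 0` for `G`-regular `γ_H ∈ H_v`, `v` non-split (★ `weylOrder T` is
`Nat.card (N(T) ⧸ T.subgroupOf N(T))`, i.e. the index, definitionally). [cite: Rogawski1990, §3.6 p. 29; §12.5 p. 183] -/
theorem weylOrder_centralizer_ne_zero (hns : ∀ w : PlacesOver L v, IsCMField.complexConj L • w.1 = w.1)
    (γH : (UnitaryGroup.cmDatum L 2 (Matrix.of fun i j : Fin 2 => if i.val + j.val + 1 = 2 then (1 : L) else 0)).Local v ×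
      (UnitaryGroup.cmDatum L 1 (Matrix.of fun i j : Fin 1 => if i.val + j.val + 1 = 1 then (1 : L) else 0)).Local v)
    (hreg : IsLocalGRegular L v γH) :
    Ch12Sec5.weylOrder (Subgroup.centralizer ({γH} : Set ((UnitaryGroup.cmDatum L 2 (Matrix.of fun i j : Fin 2 => if i.val + j.val + 1 = 2 then (1 : L) else 0)).Local v ×
      (UnitaryGroup.cmDatum L 1 (Matrix.of fun i j : Fin 1 => if i.val + j.val + 1 = 1 then (1 : L) else 0)).Local v))) ≠ 0 :=
  index_centralizer_subgroupOf_normalizer_ne_zero L v hns γH hreg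

/-- `0 < Ch12Sec5.weylOrder (Z_H(γ_H))` for `G`-regular `γ_H ∈ H_v`, `v` non-split. [cite: Rogawski1990, §3.6 p. 29; §12.5 p. 183] -/
theorem weylOrder_centralizer_pos (hns : ∀ w : PlacesOver L v, IsCMField.complexConj L • w.1 = w.1)
    (γH : (UnitaryGroup.cmDatum L 2 (Matrix.of fun i j : Fin 2 => if i.val + j.val + 1 = 2 then (1 : L) else 0)).Local v ×
      (UnitaryGroup.cmDatum L 1 (Matrix.of fun i j : Fin 1 => if i.val + j.val + 1 = 1 then (1 : L) else 0)).Local v)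
    (hreg : IsLocalGRegular L v γH) :
    0 < Ch12Sec5.weylOrder (Subgroup.centralizer ({γH} : Set ((UnitaryGroup.cmDatum L 2 (Matrix.of fun i j : Fin 2 => if i.val + j.val + 1 = 2 then (1 : L) else 0)).Local v ×
      (UnitaryGroup.cmDatum L 1 (Matrix.of fun i j : Fin 1 => if i.val + j.val + 1 = 1 then (1 : L) else 0)).Local v))) :=
  Nat.pos_of_ne_zero (weylOrder_centralizer_ne_zero L v hns γH hreg)

end Summit.HodgeConjecture.HodgeConjecture.Cruxes.H413.F0P3cStCharTSUpTrWeylFinH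

end
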